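import Summits.AnomalousDissipation.AnomalousDissipation.Theses.ImpulseGrid
import Summits.AnomalousDissipation.AnomalousDissipation.Theses.Correlation
import Summits.AnomalousDissipation.AnomalousDissipation.Theorems.ImpulseGridGridThesisGlue
import Summits.AnomalousDissipation.AnomalousDissipation.Theorems.ImpulseGridAssembly
import Summits.AnomalousDissipation.AnomalousDissipation.Theorems.ImpulseGridGridInjectionIdentity
import Summits.AnomalousDissipation.AnomalousDissipation.Theorems.ImpulseGridBoundedEnergyNoLeakGridOfNoMeanLeakage
import Summits.AnomalousDissipation.AnomalousDissipation.Theorems.ImpulseGridBoundedEnergyNoLeakGridHardnessLH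
import Summits.AnomalousDissipation.AnomalousDissipation.Theorems.BoundedEnergyNoLeakGrid.Negative.FalseOfEnergyUnboundedNegZM
import Summits.AnomalousDissipation.AnomalousDissipation.Theorems.ImpulseGridBoundedEnergyNoLeakGridOfRegularDriftStates
import Summits.AnomalousDissipation.AnomalousDissipation.Theorems.ImpulseGridBoundedEnergyNoLeakGridStubGalileanDriftTransfer
import Summits.AnomalousDissipation.AnomalousDissipation.Theorems.ImpulseGridBoundedEnergyNoLeakGridStubClassicalWitnessReduction

/-!
# STRATEGY CENSUS — Lean companion (crux-strategist, wall-breaker gen 1, 2026-08-17)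

Crux `ImpulseGrid.BoundedEnergyNoLeakGrid` (item stmt-AnomalousDissipation-14350, route ImpulseGrid rev 5).
Sorry-free certificates quoted by `Cruxes/BoundedEnergyNoLeakGrid/STRATEGY-CENSUS.md`:

* §1 THE PINCER.  Upper pin: at the design the route consumes (a `GridSignsLaw` design) the crux is
  SUMMIT-STRENGTH — `BoundedEnergyNoLeakGrid → GridSignsLaw → AnomalousDissipation` by the route's own landed chain
  (glue p-stmt-14351, `GridInjectionIdentity` stmt-1774, `Assembly` stmt-1776, `closes`).  Lower pin: at the unused
  design `Φ ≡ 1` the crux implies Correlation's `[open-problem]` item stmt-14640 (p118293) and is refuted by stmt-14642 (p119194).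
* §2 DECOMPOSITION D1 (Leray–Hopf level, typed): `UEDF → Correlation.NoMeanLeakage → crux` (glue = p120437) together with the
  NECESSITY `crux → UEDF` (p110786) — the piece `UEDF` is the whole existence-side crux.
* §3 DECOMPOSITION D2 (drift frame, typed): bounded eternal REGULAR momentum-free families under the SWEPT force ⇒ crux
  (glue = p106921 ∘ p103646); its single open piece is again ≥ UEDF's regular form.
* §4 STRENGTHEN: the synchronous (time-periodic-in-the-drift-frame) form `S⁺` as a signature, and `S⁺ → crux`.
* §5 NEGATION: the typed obstruction `MarchioroAtSomeGridDesign` (a 3-D laminar-attraction theorem at ONE design) and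
  `MarchioroAtSomeGridDesign → ¬ crux`; the only instance route on the ledger is stmt-14642 (§1).
-/

set_option linter.dupNamespace false

namespace Summit.AnomalousDissipation.AnomalousDissipation.Cruxes.BoundedEnergyNoLeakGrid.StrategyCensus

open MeasureTheory Filter Set
open Literature.Analysis.FunctionSpaces Literature.Analysis.FunctionSpaces.Torus
open Literature.Analysis.FluidPDE Literature.Analysis.FluidPDE.Torus
open Summit.AnomalousDissipation.AnomalousDissipation.Theses
open Summit.AnomalousDissipation.AnomalousDissipation.Theses.ImpulseGrid

local notation "𝕋³" => UnitAddTorus (Fin 3)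
local notation "E³" => EuclideanSpace ℝ (Fin 3)

/-! ## §1 The pincer -/

/-- **Upper pin (summit-strength at the consumed design).**  The crux together with the route's other crux `GridSignsLaw`
already IS the summit, by the landed chain `gridThesisGlue_proof` (stmt-14351) → `closes` with
`impulseGrid_gridInjectionIdentity` (stmt-1774) and `impulseGridAssembly_proof` (stmt-1776).  With TRIAGE-r1-1 COMMON (2):
at a sign-law design every bounded no-leak drift family dissipates `≥ η/(2c)`, so a witness of the crux there is a
zeroth-law witness. -/
theorem summit_of_crux_of_gridSignsLaw :
    BoundedEnergyNoLeakGrid → GridSignsLaw → _root_.AnomalousDissipation :=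
  fun hB hL =>
    -- buildfix 2026-08-19: `closes` was re-threaded through the AC/DC items (rev ≥ 8); the landed chain
    -- GridThesisGlue → Assembly(GridInjectionIdentity, GridThesis) is applied directly, statement unchanged.
    (Theorems.impulseGridAssembly_proof : GridInjectionIdentity → GridThesis → _root_.AnomalousDissipation)
      Theorems.impulseGrid_gridInjectionIdentity
      ((Theorems.gridThesisGlue_proof : BoundedEnergyNoLeakGrid → GridSignsLaw → GridThesis) hB hL)

/-- **Lower pin (a): crux ⇒ stmt-14640** (`Correlation.BoundedEnergyEqualityZM`, `[open-problem]`), via the admissible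
design `Φ ≡ 1, G = sin(2πx₁)e₂, c = 1` and the Galilean covariance of global Leray–Hopf solutions (p118293). -/
theorem boundedEnergyEqualityZM_of_crux :
    BoundedEnergyNoLeakGrid → Correlation.BoundedEnergyEqualityZM :=
  Theorems.boundedEnergyEqualityZM_of_boundedEnergyNoLeakGrid

/-- **Lower pin (b): crux ⇒ stmt-14641** (`Correlation.BoundedEnergyFamilyZM`, turbulent saturation at zero momentum). -/
theorem boundedEnergyFamilyZM_of_crux :
    BoundedEnergyNoLeakGrid → Correlation.BoundedEnergyFamilyZM :=
  Theorems.boundedEnergyFamilyZM_of_boundedEnergyNoLeakGrid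

/-- **Lower pin (c): stmt-14642 ⇒ ¬crux** (`Correlation.EnergyUnboundedNegZM`; p119194). -/
theorem not_crux_of_energyUnboundedNegZM :
    Correlation.EnergyUnboundedNegZM → ¬ BoundedEnergyNoLeakGrid :=
  Theorems.BoundedEnergyNoLeakGrid_false_of_EnergyUnboundedNegZM

/-! ## §2 Decomposition D1 (Leray–Hopf level): `UEDF ∧ Correlation.NoMeanLeakage` -/

/-- **Sub₁ = UEDF** (uniform-energy drift families): for every grid design, `ν_j → 0⁺` and global Leray–Hopf families with
drift datum `c e₀` and `j`-uniformly bounded limsup-mean energy.  (= the registered stub `stub_uniformEnergyDriftFamilies`.) -/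
def UniformEnergyDriftFamilies : Prop :=
  ∀ (Φ : 𝕋³ → ℝ) (G : 𝕋³ → E³) (c : ℝ), IsSmooth Φ → IsSmooth G →
    (∀ (s : UnitAddCircle) x, Φ (x + Pi.single (1 : Fin 3) s) = Φ x ∧ Φ (x + Pi.single (2 : Fin 3) s) = Φ x) →
    (∫ x, Φ x = 1) → (∀ (s : UnitAddCircle) x, G (x + Pi.single (0 : Fin 3) s) = G x) → (∀ x, G x 0 = 0) →
    IsSmooth (fun x => Φ x • G x) → IsDivFree (fun x => Φ x • G x) → HasZeroMean (fun x => Φ x • G x) →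
    0 < c →
    ∃ (ν : ℕ → ℝ) (u₀ : ℕ → 𝕋³ → E³) (u : ℕ → ℝ → 𝕋³ → E³),
      (∀ j, 0 < ν j) ∧ Filter.Tendsto ν Filter.atTop (nhds 0) ∧
      (∀ j, IsGlobalLerayHopf (ν j) (fun _ => fun x => Φ x • G x) (u₀ j) (u j)) ∧
      (∀ j, ∫ x, u₀ j x = c • EuclideanSpace.single 0 1) ∧
      (∃ E : ℝ, ∀ j, meanEnergy (u j) ≤ E)

/-- **Sub₂** is the EXISTING item `Correlation.NoMeanLeakage` (stmt-AnomalousDissipation-14265), shared, not re-filed. -/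
abbrev NoMeanLeakage : Prop := Correlation.NoMeanLeakage

/-- **D1 glue**: `Sub₁ → Sub₂ → crux` (= p120437, cap discharged by p110941). -/
theorem BoundedEnergyNoLeakGrid_of_subs :
    UniformEnergyDriftFamilies → NoMeanLeakage → BoundedEnergyNoLeakGrid :=
  fun hU hN => Theorems.boundedEnergyNoLeakGrid_of_noMeanLeakage_of_uedf hN hU

/-- **Why D1 gives no leverage**: `Sub₁` is NECESSARY (p110786) — it is the crux with two clauses dropped. -/
theorem uedf_of_crux : BoundedEnergyNoLeakGrid → UniformEnergyDriftFamilies :=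
  Theorems.uniformEnergyDriftFamilies_of_boundedEnergyNoLeakGrid

/-- and under `Sub₂` alone the crux IS `Sub₁`. -/
theorem crux_iff_uedf (hN : NoMeanLeakage) : BoundedEnergyNoLeakGrid ↔ UniformEnergyDriftFamilies :=
  Theorems.boundedEnergyNoLeakGrid_iff_uedf_of_noMeanLeakage hN

/-! ## §3 Decomposition D2 (drift frame, regular level): swept-force bounded eternal regular families -/

/-- **Sub = SweptRegularFamilies**: for every grid design, `ν_j → 0⁺` and ETERNAL CLASSICAL solutions `(w_j, q_j)` on `ℝ × T³`
of NS forced by the SWEPT force `(t, y) ↦ (Φ•G)(y + [t c e₀])` (time-periodic of period `1/c`), momentum-free datum and a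
`j`-uniform forward kinetic-energy cap.  At `Φ ≡ 1` the swept force is the steady columnar `G`. -/
def SweptRegularFamilies : Prop :=
  ∀ (Φ : 𝕋³ → ℝ) (G : 𝕋³ → E³) (c : ℝ), IsSmooth Φ → IsSmooth G →
    (∀ (s : UnitAddCircle) x, Φ (x + Pi.single (1 : Fin 3) s) = Φ x ∧ Φ (x + Pi.single (2 : Fin 3) s) = Φ x) →
    (∫ x, Φ x = 1) → (∀ (s : UnitAddCircle) x, G (x + Pi.single (0 : Fin 3) s) = G x) → (∀ x, G x 0 = 0) →
    IsSmooth (fun x => Φ x • G x) → IsDivFree (fun x => Φ x • G x) → HasZeroMean (fun x => Φ x • G x) →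
    0 < c →
    ∃ (ν : ℕ → ℝ) (w : ℕ → ℝ → 𝕋³ → E³) (q : ℕ → ℝ → 𝕋³ → ℝ) (E : ℝ),
      (∀ j, 0 < ν j) ∧ Tendsto ν atTop (nhds 0) ∧
      (∀ j, IsClassicalNSSolutionOn Set.univ (ν j)
        (fun t y => Φ (y + Torus.proj (t • (c • EuclideanSpace.single (0 : Fin 3) (1 : ℝ)))) •
          G (y + Torus.proj (t • (c • EuclideanSpace.single (0 : Fin 3) (1 : ℝ))))) (w j) (q j)) ∧
      (∀ j, ∫ y, w j 0 y = 0) ∧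
      (∀ j t, 0 ≤ t → kineticEnergy (w j t) ≤ E)

/-- **D2 glue**: `SweptRegularFamilies → crux` (Galilean boost p106921, then classical witnesses p103646). -/
theorem BoundedEnergyNoLeakGrid_of_sweptRegular : SweptRegularFamilies → BoundedEnergyNoLeakGrid := by
  intro hS Φ G c h1 h2 h3 h4 h5 h6 h7 h8 h9 h10
  exact Theorems.BoundedEnergyNoLeakGrid.stub_classicalWitnessReduction Φ G c h1 h2 h3 h4 h5 h6 h7 h8 h9 h10
    (Theorems.BoundedEnergyNoLeakGrid.stub_galileanDriftTransfer Φ G c h1 h2 h3 h4 h5 h6 h7 h8 h9 h10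
      (hS Φ G c h1 h2 h3 h4 h5 h6 h7 h8 h9 h10))

/-! ## §4 Strengthen: the synchronous form `S⁺` -/

/-- **S⁺ = BoundedSynchronousFamilies**: as `SweptRegularFamilies`, and in addition each `w_j` is SYNCHRONOUS
(time-periodic with the forcing period `1/c`).  The added rigidity gives a fixed-point formulation for the period map
(Leray–Schauder existence at each `ν > 0`), but nothing that selects the energy scale. -/
def BoundedSynchronousFamilies : Prop :=
  ∀ (Φ : 𝕋³ → ℝ) (G : 𝕋³ → E³) (c : ℝ), IsSmooth Φ → IsSmooth G →
    (∀ (s : UnitAddCircle) x, Φ (x + Pi.single (1 : Fin 3) s) = Φ x ∧ Φ (x + Pi.single (2 : Fin 3) s) = Φ x) →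
    (∫ x, Φ x = 1) → (∀ (s : UnitAddCircle) x, G (x + Pi.single (0 : Fin 3) s) = G x) → (∀ x, G x 0 = 0) →
    IsSmooth (fun x => Φ x • G x) → IsDivFree (fun x => Φ x • G x) → HasZeroMean (fun x => Φ x • G x) →
    0 < c →
    ∃ (ν : ℕ → ℝ) (w : ℕ → ℝ → 𝕋³ → E³) (q : ℕ → ℝ → 𝕋³ → ℝ) (E : ℝ),
      (∀ j, 0 < ν j) ∧ Tendsto ν atTop (nhds 0) ∧
      (∀ j, IsClassicalNSSolutionOn Set.univ (ν j)
        (fun t y => Φ (y + Torus.proj (t • (c • EuclideanSpace.single (0 : Fin 3) (1 : ℝ)))) •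
          G (y + Torus.proj (t • (c • EuclideanSpace.single (0 : Fin 3) (1 : ℝ))))) (w j) (q j)) ∧
      (∀ j, ∫ y, w j 0 y = 0) ∧
      (∀ j t, 0 ≤ t → kineticEnergy (w j t) ≤ E) ∧
      (∀ j t, w j (t + 1 / c) = w j t)

/-- `S⁺ → crux` (drop synchrony, apply D2). -/
theorem BoundedEnergyNoLeakGrid_of_synchronous : BoundedSynchronousFamilies → BoundedEnergyNoLeakGrid := by
  intro hS
  refine BoundedEnergyNoLeakGrid_of_sweptRegular ?_
  intro Φ G c h1 h2 h3 h4 h5 h6 h7 h8 h9 h10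
  obtain ⟨ν, w, q, E, hν, hν0, hcl, hdat, hE, -⟩ := hS Φ G c h1 h2 h3 h4 h5 h6 h7 h8 h9 h10
  exact ⟨ν, w, q, E, hν, hν0, hcl, hdat, hE⟩

/-! ## §5 Negation: the typed obstruction -/

/-- **MarchioroAtSomeGridDesign** — what a refutation of the ∀-design crux must supply: ONE admissible grid design at which
EVERY vanishing-viscosity global Leray–Hopf drift family has unbounded limsup-mean energies (a 3-D laminar global-attraction
theorem at every small `ν`; in 2-D and first shell this is Marchioro 1986, in tree). -/
def MarchioroAtSomeGridDesign : Prop :=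
  ∃ (Φ : 𝕋³ → ℝ) (G : 𝕋³ → E³) (c : ℝ), IsSmooth Φ ∧ IsSmooth G ∧
    (∀ (s : UnitAddCircle) x, Φ (x + Pi.single (1 : Fin 3) s) = Φ x ∧ Φ (x + Pi.single (2 : Fin 3) s) = Φ x) ∧
    (∫ x, Φ x = 1) ∧ (∀ (s : UnitAddCircle) x, G (x + Pi.single (0 : Fin 3) s) = G x) ∧ (∀ x, G x 0 = 0) ∧
    IsSmooth (fun x => Φ x • G x) ∧ IsDivFree (fun x => Φ x • G x) ∧ HasZeroMean (fun x => Φ x • G x) ∧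
    0 < c ∧
    ∀ (ν : ℕ → ℝ) (u₀ : ℕ → 𝕋³ → E³) (u : ℕ → ℝ → 𝕋³ → E³),
      (∀ j, 0 < ν j) → Filter.Tendsto ν Filter.atTop (nhds 0) →
      (∀ j, IsGlobalLerayHopf (ν j) (fun _ => fun x => Φ x • G x) (u₀ j) (u j)) →
      (∀ j, ∫ x, u₀ j x = c • EuclideanSpace.single 0 1) →
      ∀ E : ℝ, ∃ j, E < meanEnergy (u j)

/-- The obstruction refutes the crux (indeed already its necessary residual UEDF). -/
theorem not_uedf_of_marchioro : MarchioroAtSomeGridDesign → ¬ UniformEnergyDriftFamilies := by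
  rintro ⟨Φ, G, c, h1, h2, h3, h4, h5, h6, h7, h8, h9, h10, hM⟩ hU
  obtain ⟨ν, u₀, u, hν, hν0, hLH, hdat, E, hE⟩ := hU Φ G c h1 h2 h3 h4 h5 h6 h7 h8 h9 h10
  obtain ⟨j, hj⟩ := hM ν u₀ u hν hν0 hLH hdat E
  exact absurd (hE j) (not_le.mpr hj)

theorem not_crux_of_marchioro : MarchioroAtSomeGridDesign → ¬ BoundedEnergyNoLeakGrid :=
  fun hM hB => not_uedf_of_marchioro hM (uedf_of_crux hB)

end Summit.AnomalousDissipation.AnomalousDissipation.Cruxes.BoundedEnergyNoLeakGrid.StrategyCensus
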